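import Summits.BirchSwinnertonDyer.BirchSwinnertonDyer.Theorems.ManinLocalTwoThreeCuspValuesOfTranslatesGamma1
import Literature.NumberTheory.EllipticCurves.ManinConstantGamma1ModularDegree
import HarnessLib

/-!
# Stevens' formula `σ(π(c{∞,1/y})) = π(c{∞,1/(d′y)})` from a Galois action on `q_N`-coefficients of translates — the assembly of step (2)
(route `ManinLocalTwoThree`, crux C2 `ManinOddAtFour` stmt-BirchSwinnertonDyer-22967; cell bsd-f2-manin, prover seat p2 gen 23;
`--supports stmt-BirchSwinnertonDyer-22967`; the LAST glue of the LEAD's road to T-es-75 = `optimalGamma1Parametrization_cuspInv_galoisAction`: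
everything except STEP (1) «`σ(coeff_n(F ∣ g)) = coeff_n(F ∣ g′)` for rational `F ∈ S_k(Γ₁(N))`» is supplied)

INPUT SHAPE.  A uniformisation `π : ℂ →+ W(ℂ)` of an elliptic `W/ℚ` by a period pair `L` (kernel `Λ`, `℘`-formula off `Λ` — the fields of a
`Gamma1ParametrizationData` / `ModularParametrizationData`), `f ∈ S₂(Γ₀(N))` nonzero, `c ≠ 0`, two presentations by cusp forms on `Γ₁(N)`:
`G·℘_Λ(c·ℰ_f) = F` and `Gʸ·℘_Λ'(c·ℰ_f) = Fʸ` off the poles (p3 gen 21 `StevensCurve.exists_rat_gamma1_presentation` + its `y`-twin), two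
translating matrices `g, g′ ∈ SL₂(ℤ)` with `g∞ = r`, `g′∞ = r′`, and a `ℚ`-algebra automorphism `σ` of `ℂ` acting on the `q_N`-coefficients of
the four translates by `g ↦ g′`:  `σ(coeff_n(Φ ∣[k] g)) = coeff_n(Φ ∣[k] g′)` for `Φ ∈ {F, G, Fʸ, Gʸ}` (the LEAD's STEP (1), Shimura reciprocity,
taken as the hypothesis `hσ`).  OUTPUT (`map_uniformize_cuspValue_of_galois_on_translates`):  `σ(π(c·{∞,r}_f)) = π(c·{∞,r′}_f)`.
With `r = 1/y`, `r′ = 1/(d′y)` this is Stevens 1982 Thm. 1.3.1 (b) for the datum (`stevens_formula_of_galois_on_translates`).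

Proof: `m` = first non-vanishing coefficient of `G ∣ g` is also that of `G ∣ g′` (`σ` is injective on coefficients); the cusp value is `O` iff a
coefficient of `F ∣ g` below `m` survives (`CuspValues.mem_lattice_iff_exists_coeff_ne_zero`), a condition `σ` transports; off `O` both coordinates
are coefficient ratios (`CuspValues.coeff_slash_eq_weierstrassP_mul` / `…derivWeierstrassP_mul`), which `σ` transports, and `σ` fixes the
rational `a₁, a₃, b₂` of the model.  Fact-free; nothing about T-es-75 itself (STEP (1) is a hypothesis), C2, Manin's conjecture or BSD is proved.
No definitions, no sorry. [cite: Stevens1982, §1.3 Thm. 1.3.1 (b)] [cite: ShimuraIATAF1971, §6.1–6.2, Prop. 6.9] [cite: Manin1972, §1.5]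
-/

set_option autoImplicit false
-- lint-debt: the directory name repeats the summit name (sibling precedent `ManinLocalTwoThreeCuspValuesOfTranslatesGamma1.lean`)
set_option linter.dupNamespace false

noncomputable section

open scoped MatrixGroups ModularForm Topology PeriodPair
open Complex Filter Function CongruenceSubgroup WeierstrassCurve
open UpperHalfPlane hiding I
open Literature.NumberTheory.EllipticCurves Literature.NumberTheory.EllipticCurves.ModularForms

namespace Summit.BirchSwinnertonDyer.BirchSwinnertonDyer.Theorems.ManinLocalTwoThree.CuspValues

variable {N : ℕ} [NeZero N] {k : ℤ}

/-- A nonzero cusp form on `Γ₁(N)` has a nonzero `q_N`-coefficient after translating by any `g ∈ SL₂(ℤ)`, hence a FIRST one. [folklore] -/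
theorem exists_first_coeff_slash_ne_zero (G : CuspForm (Gamma1 N) k) (hG : (⇑G : ℍ → ℂ) ≠ 0) (g : SL(2, ℤ)) :
    ∃ m : ℕ, (qExpansion ((N : ℕ) : ℝ) (⇑G ∣[k] g)).coeff m ≠ 0 ∧ ∀ n < m, (qExpansion ((N : ℕ) : ℝ) (⇑G ∣[k] g)).coeff n = 0 := by
  classical
  have hφ := isCuspFunction_slash_gamma1 G g
  have hN : (0 : ℝ) < N := Nat.cast_pos.mpr (NeZero.pos N)
  -- the translate is not identically zero
  have hne : (⇑G ∣[k] g : ℍ → ℂ) ≠ 0 := by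
    intro h0
    apply hG
    have := congrArg (fun F : ℍ → ℂ ↦ F ∣[k] g⁻¹) h0
    simpa [← SlashAction.slash_mul, SlashAction.zero_slash] using this
  -- hence its `q_N`-expansion is nonzero
  have hex : ∃ m : ℕ, (qExpansion ((N : ℕ) : ℝ) (⇑G ∣[k] g)).coeff m ≠ 0 := by
    by_contra hall
    push Not at hall
    apply hne
    funext τ
    have hsum := hasSum_qExpansion hN hφ.periodic hφ.mdifferentiable hφ.isZeroAtImInfty.boundedAtFilter τ
    simp only [hall, zero_smul] at hsum
    exact hsum.unique hasSum_zero
  exact ⟨Nat.find hex, Nat.find_spec hex, fun n hn ↦ by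
    by_contra h; exact Nat.find_min hex hn h⟩

/-- **Stevens' formula from a Galois action on coefficients of translates (general cusps).**  See the module docstring for the input shape.
[cite: Stevens1982, §1.3 Thm. 1.3.1 (b)] [cite: ShimuraIATAF1971, §6.1–6.2, Prop. 6.9] -/
theorem map_uniformize_cuspValue_of_galois_on_translates {W : WeierstrassCurve ℚ} [W.IsElliptic]
    (L : PeriodPair) (u : ℂ →+ (W.baseChange ℂ).toAffine.Point) (hker : (u.ker : Set ℂ) = L.lattice)
    (hspec : ∀ z ∉ L.lattice, ∃ h, u z = .some (W' := (W.baseChange ℂ).toAffine)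
      (℘[L] z - (W.baseChange ℂ).b₂ / 12)
      ((℘'[L] z - (W.baseChange ℂ).a₁ * (℘[L] z - (W.baseChange ℂ).b₂ / 12) - (W.baseChange ℂ).a₃) / 2) h)
    (f : CuspForm (Gamma0 N) 2) (hf : f ≠ 0) {c : ℂ} (hc : c ≠ 0)
    (F G Fy Gy : CuspForm (Gamma1 N) k) (hG0 : (⇑G : ℍ → ℂ) ≠ 0) (hGy0 : (⇑Gy : ℍ → ℂ) ≠ 0)
    (hpresX : ∀ τ : ℍ, c * eichlerIntegral f τ ∉ L.lattice → G τ * ℘[L] (c * eichlerIntegral f τ) = F τ)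
    (hpresY : ∀ τ : ℍ, c * eichlerIntegral f τ ∉ L.lattice → Gy τ * ℘'[L] (c * eichlerIntegral f τ) = Fy τ)
    (g g' : SL(2, ℤ)) (hg : (g 1 0 : ℤ) ≠ 0) (hg' : (g' 1 0 : ℤ) ≠ 0) (σ : ℂ ≃ₐ[ℚ] ℂ)
    (hσ : ∀ Φ : CuspForm (Gamma1 N) k, (Φ = F ∨ Φ = G ∨ Φ = Fy ∨ Φ = Gy) → ∀ n : ℕ,
      σ ((qExpansion ((N : ℕ) : ℝ) (⇑Φ ∣[k] g)).coeff n) = (qExpansion ((N : ℕ) : ℝ) (⇑Φ ∣[k] g')).coeff n) :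
    Affine.Point.map (W' := W) (σ : ℂ →ₐ[ℚ] ℂ) (u (c * modularSymbol f (((g 0 0 : ℤ) : ℚ) / ((g 1 0 : ℤ) : ℚ)))) =
      u (c * modularSymbol f (((g' 0 0 : ℤ) : ℚ) / ((g' 1 0 : ℤ) : ℚ))) := by
  set z₀ := c * modularSymbol f (((g 0 0 : ℤ) : ℚ) / ((g 1 0 : ℤ) : ℚ)) with hz₀
  set z₀' := c * modularSymbol f (((g' 0 0 : ℤ) : ℚ) / ((g' 1 0 : ℤ) : ℚ)) with hz₀'
  have hu0 : ∀ z, u z = 0 ↔ z ∈ L.lattice := fun z ↦ by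
    rw [← AddMonoidHom.mem_ker, ← SetLike.mem_coe, hker, SetLike.mem_coe]
  -- first non-vanishing coefficients of `G ∣ g`, `G ∣ g'` (the same index, by `σ`), and of `Gy ∣ g`, `Gy ∣ g'`
  obtain ⟨m, hGm, hGlt⟩ := exists_first_coeff_slash_ne_zero G hG0 g
  have hGm' : (qExpansion ((N : ℕ) : ℝ) (⇑G ∣[k] g')).coeff m ≠ 0 := by
    rw [← hσ G (Or.inr (Or.inl rfl)) m]; exact (map_ne_zero_iff _ σ.injective).mpr hGm
  have hGlt' : ∀ n < m, (qExpansion ((N : ℕ) : ℝ) (⇑G ∣[k] g')).coeff n = 0 := fun n hn ↦ by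
    rw [← hσ G (Or.inr (Or.inl rfl)) n, hGlt n hn, map_zero]
  obtain ⟨my, hGym, hGylt⟩ := exists_first_coeff_slash_ne_zero Gy hGy0 g
  have hGym' : (qExpansion ((N : ℕ) : ℝ) (⇑Gy ∣[k] g')).coeff my ≠ 0 := by
    rw [← hσ Gy (Or.inr (Or.inr (Or.inr rfl))) my]; exact (map_ne_zero_iff _ σ.injective).mpr hGym
  have hGylt' : ∀ n < my, (qExpansion ((N : ℕ) : ℝ) (⇑Gy ∣[k] g')).coeff n = 0 := fun n hn ↦ by
    rw [← hσ Gy (Or.inr (Or.inr (Or.inr rfl))) n, hGylt n hn, map_zero]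
  -- the cusp value is `O` on both sides or on neither
  have hiff : z₀ ∈ L.lattice ↔ z₀' ∈ L.lattice := by
    rw [hz₀, hz₀', mem_lattice_iff_exists_coeff_ne_zero f hf L F G hc hpresX g hg hGm hGlt,
      mem_lattice_iff_exists_coeff_ne_zero f hf L F G hc hpresX g' hg' hGm' hGlt']
    constructor
    · rintro ⟨n, hn, hne⟩
      exact ⟨n, hn, by rw [← hσ F (Or.inl rfl) n]; exact (map_ne_zero_iff _ σ.injective).mpr hne⟩
    · rintro ⟨n, hn, hne⟩
      refine ⟨n, hn, fun h0 ↦ hne ?_⟩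
      rw [← hσ F (Or.inl rfl) n, h0, map_zero]
  have hσ' : ∀ Φ : CuspForm (Gamma1 N) k, (Φ = F ∨ Φ = G ∨ Φ = Fy ∨ Φ = Gy) → ∀ n : ℕ,
      (σ : ℂ →ₐ[ℚ] ℂ) ((qExpansion ((N : ℕ) : ℝ) (⇑Φ ∣[k] g)).coeff n) = (qExpansion ((N : ℕ) : ℝ) (⇑Φ ∣[k] g')).coeff n :=
    fun Φ h n ↦ hσ Φ h n
  by_cases hmem : z₀ ∈ L.lattice
  · -- both values are `O`
    rw [(hu0 z₀).mpr hmem, (hu0 z₀').mpr (hiff.mp hmem), map_zero]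
  · have hmem' : z₀' ∉ L.lattice := fun h ↦ hmem (hiff.mpr h)
    -- coordinates as coefficient ratios
    obtain ⟨-, hx⟩ := coeff_slash_eq_weierstrassP_mul f hf L F G hc hpresX g hg hmem hGm hGlt
    obtain ⟨-, hx'⟩ := coeff_slash_eq_weierstrassP_mul f hf L F G hc hpresX g' hg' hmem' hGm' hGlt'
    obtain ⟨-, hy⟩ := coeff_slash_eq_derivWeierstrassP_mul f hf L Fy Gy hc hpresY g hg hmem hGym hGylt
    obtain ⟨-, hy'⟩ := coeff_slash_eq_derivWeierstrassP_mul f hf L Fy Gy hc hpresY g' hg' hmem' hGym' hGylt'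
    have h℘ : (σ : ℂ →ₐ[ℚ] ℂ) (℘[L] z₀) = ℘[L] z₀' := by
      have e1 : ℘[L] z₀ = (qExpansion ((N : ℕ) : ℝ) (⇑F ∣[k] g)).coeff m / (qExpansion ((N : ℕ) : ℝ) (⇑G ∣[k] g)).coeff m := by
        rw [eq_div_iff hGm, ← hx]
      have e2 : ℘[L] z₀' = (qExpansion ((N : ℕ) : ℝ) (⇑F ∣[k] g')).coeff m / (qExpansion ((N : ℕ) : ℝ) (⇑G ∣[k] g')).coeff m := by
        rw [eq_div_iff hGm', ← hx']
      rw [e1, e2, map_div₀, hσ' F (Or.inl rfl) m, hσ' G (Or.inr (Or.inl rfl)) m]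
    have h℘' : (σ : ℂ →ₐ[ℚ] ℂ) (℘'[L] z₀) = ℘'[L] z₀' := by
      have e1 : ℘'[L] z₀ = (qExpansion ((N : ℕ) : ℝ) (⇑Fy ∣[k] g)).coeff my / (qExpansion ((N : ℕ) : ℝ) (⇑Gy ∣[k] g)).coeff my := by
        rw [eq_div_iff hGym, ← hy]
      have e2 : ℘'[L] z₀' = (qExpansion ((N : ℕ) : ℝ) (⇑Fy ∣[k] g')).coeff my / (qExpansion ((N : ℕ) : ℝ) (⇑Gy ∣[k] g')).coeff my := by
        rw [eq_div_iff hGym', ← hy']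
      rw [e1, e2, map_div₀, hσ' Fy (Or.inr (Or.inr (Or.inl rfl))) my, hσ' Gy (Or.inr (Or.inr (Or.inr rfl))) my]
    -- `σ` fixes the rational coefficients of the model
    have ha₁ : (σ : ℂ →ₐ[ℚ] ℂ) (W.baseChange ℂ).a₁ = (W.baseChange ℂ).a₁ := by
      rw [show (W.baseChange ℂ).a₁ = (W.a₁ : ℂ) by simp [WeierstrassCurve.baseChange, WeierstrassCurve.map_a₁]]
      exact map_ratCast _ _
    have ha₃ : (σ : ℂ →ₐ[ℚ] ℂ) (W.baseChange ℂ).a₃ = (W.baseChange ℂ).a₃ := by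
      rw [show (W.baseChange ℂ).a₃ = (W.a₃ : ℂ) by simp [WeierstrassCurve.baseChange, WeierstrassCurve.map_a₃]]
      exact map_ratCast _ _
    have hb₂ : (σ : ℂ →ₐ[ℚ] ℂ) (W.baseChange ℂ).b₂ = (W.baseChange ℂ).b₂ := by
      rw [show (W.baseChange ℂ).b₂ = (W.b₂ : ℂ) by simp [WeierstrassCurve.baseChange, WeierstrassCurve.map_b₂]]
      exact map_ratCast _ _
    -- the explicit points
    obtain ⟨hns, hP⟩ := hspec z₀ hmem
    obtain ⟨hns', hP'⟩ := hspec z₀' hmem'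
    rw [hP, hP', Affine.Point.map_some]
    simp only [Affine.Point.some.injEq]
    constructor <;> simp only [map_div₀, map_sub, map_mul, map_ofNat, h℘, h℘', ha₁, ha₃, hb₂]

/-- **Stevens' formula (b) at the cusps `1/y ↦ 1/(d′y)` for an `X₁(N)`-datum, from STEP (1).**  For `D : Gamma1ParametrizationData W N`
(`π = D.uniformize`, `Λ = Λ(D.L)`, `c = D.c ≠ 0`), presentations of `℘_Λ(c·ℰ_f)` and `℘_Λ'(c·ℰ_f)` by cusp forms on `Γ₁(N)`, matrices
`g, g′ ∈ SL₂(ℤ)` with `g∞ = 1/y`, `g′∞ = 1/(d′y)`, and `σ` acting on the coefficients of the four translates by `g ↦ g′`: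
`σ(π(c·{∞,1/y}_f)) = π(c·{∞,1/(d′y)}_f)` — the conclusion of `optimalGamma1Parametrization_cuspInv_galoisAction` for `D, σ, y` (no optimality
used).  CONDITIONAL only on the hypothesis `hσ` (Shimura reciprocity on translates, the LEAD's STEP (1)); fact-free otherwise.
[cite: Stevens1982, §1.3 Thm. 1.3.1 (b)] [cite: ShimuraIATAF1971, Prop. 6.9] -/
theorem stevens_formula_of_galois_on_translates {W : WeierstrassCurve ℚ} [W.IsElliptic] (D : Gamma1ParametrizationData W N)
    (hf : D.f ≠ 0) (F G Fy Gy : CuspForm (Gamma1 N) k) (hG0 : (⇑G : ℍ → ℂ) ≠ 0) (hGy0 : (⇑Gy : ℍ → ℂ) ≠ 0)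
    (hpresX : ∀ τ : ℍ, (D.c : ℂ) * eichlerIntegral D.f τ ∉ D.L.lattice → G τ * ℘[D.L] ((D.c : ℂ) * eichlerIntegral D.f τ) = F τ)
    (hpresY : ∀ τ : ℍ, (D.c : ℂ) * eichlerIntegral D.f τ ∉ D.L.lattice → Gy τ * ℘'[D.L] ((D.c : ℂ) * eichlerIntegral D.f τ) = Fy τ)
    (y d' : ℤ) (g g' : SL(2, ℤ)) (hg : (g 1 0 : ℤ) ≠ 0) (hg' : (g' 1 0 : ℤ) ≠ 0)
    (hgr : ((g 0 0 : ℤ) : ℚ) / ((g 1 0 : ℤ) : ℚ) = 1 / y) (hgr' : ((g' 0 0 : ℤ) : ℚ) / ((g' 1 0 : ℤ) : ℚ) = 1 / (d' * y))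
    (σ : ℂ ≃ₐ[ℚ] ℂ)
    (hσ : ∀ Φ : CuspForm (Gamma1 N) k, (Φ = F ∨ Φ = G ∨ Φ = Fy ∨ Φ = Gy) → ∀ n : ℕ,
      σ ((qExpansion ((N : ℕ) : ℝ) (⇑Φ ∣[k] g)).coeff n) = (qExpansion ((N : ℕ) : ℝ) (⇑Φ ∣[k] g')).coeff n) :
    Affine.Point.map (W' := W) (σ : ℂ →ₐ[ℚ] ℂ) (D.uniformize ((D.c : ℂ) * modularSymbol D.f (1 / y))) =
      D.uniformize ((D.c : ℂ) * modularSymbol D.f (1 / (d' * y))) := by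
  have hc : (D.c : ℂ) ≠ 0 := by exact_mod_cast D.maninConstant_ne_zero
  have h := map_uniformize_cuspValue_of_galois_on_translates D.L D.uniformize D.ker_uniformize D.uniformize_spec D.f hf hc
    F G Fy Gy hG0 hGy0 hpresX hpresY g g' hg hg' σ hσ
  rwa [hgr, hgr'] at h

end Summit.BirchSwinnertonDyer.BirchSwinnertonDyer.Theorems.ManinLocalTwoThree.CuspValues

end
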